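import Summits.Ventures.LatticeQCDFlow.Scaling.SectorExactManySectorsLaw
import Summits.Ventures.LatticeQCDFlow.Scaling.TwoLevelCycleLaw

/-!
HONEST FRAMING: exact (Metropolis-corrected) sampling algorithms for lattice gauge theory; figures
of merit are autocorrelation/cost numbers at stated couplings and volumes; no continuum-physics
claim.

# SectorExactTwoLevelLaw — OPEN-MATH ITEM 1 (i) FOR ONE COLD LEVEL: PARTITION-EXACT FLOWS WITH ANY NUMBER OF SECTORS ON ANY FINITE `S`,
# ONE-SIDED DOMINATION `p·c_r(b) ≤ 1` ONLY: `d(n) ≤ ((θ+1)/θ)(1−δ)^{⌊n/2⌋} + 3(1 − p·t·h/(2(2t+h)))ⁿ` AND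
# `t_mix(ε) ≤ max{2⌈ρ⁻¹log(2(1+(2t+h)/(2t))/ε)⌉, ⌈(2(2t+h)/(pth))·log(6/ε)⌉}` — FREE OF `|S|`, OF `π̃_min`, OF `log(1/w_min)` AND OF ANY
# REGIME (lean-2 GEN-31, ours)

Venture-side (OURS).  Cell `lqcd-flow` (pub-lqcd), unit `pub-lqcd-lean-2-g31`, 2026-08-29.  Chapter R, file 5.  Setting of chapter Q
(`Scaling/SectorExactAugmentation` … `Scaling/SectorExactManySectorsLaw`) with ONE cold level: `S^{Fin 2}`, a label map `ℓ : S → L` (any finite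
`L`, i.e. any number of sectors), `m ≥ 1` entries with maps `φ_r` preserving the labels and SECTOR-EXACT (`μ_1(φ_r u) = c_r(ℓu)·μ_0(u)`), exact hot
redraws, a `μ_1`-stationary SECTOR-CONFINED cold kernel, `0 < t < 1`, `w ≥ 0`, `Σw = 1`, `w_0 > 0`, `h = (1−t)w_0`, and one-sided domination
`p·c_r(b) ≤ 1` (`0 < p ≤ 1`).  `Scaling/SectorExactHubDominationLaw` (Q13) reduced the cold start to the stale part plus the LABEL STAR's worst
total variation `d_L(n)`, for any number of sectors; `Scaling/SectorExactManySectorsLaw` (Q14) bounded `d_L` spectrally, paying `log(1/π̃^L_min)`.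
With one cold level the label star is exactly the two-level scheme of `Scaling/TwoLevelCycleLaw` (identity map, exact label redraw, idle cold
label, domination `p·μ^L_1 ≤ μ^L_0` by `labelStar_basic`), so `d_L(n) ≤ 3(1 − p·t·h/(2(2t+h)))ⁿ` with NO least mass at all.

## What is proved

* **`sectorExact_twoLevel_worstTvDist_le`** — `d(n) ≤ ((θ+1)/θ)·(1 − min{h(1−θ)pct/m, (hθ−(1−θ)t)/(1+θ)})^{⌊n/2⌋} + 3·(1 − p·t·h/(2(2t+h)))ⁿ`
  (`0 < θ ≤ 1`, `(1−θ)t ≤ hθ`, hub multiplicity `c`).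
* **`sectorExact_twoLevel_mixingTime_le`** — at `θ = 2t/(2t+h)`:
  `t_mix(ε) ≤ max{2⌈((2t+h)/(th·min{hpc/m, 1/2}))·log(2(1+(2t+h)/(2t))/ε)⌉, ⌈(2(2t+h)/(p·t·h))·log(6/ε)⌉}` (`0 < ε`).

Reading (no numerics implied): for ONE cold level the cold-start law of a partition-exact flow with ANY number of sectors is free of the
configuration-space volume, of every least mass (no `π̃_min`, no `π̃^L_min`, no `w_min`) and of any regime — OPEN-MATH item 1 (i) closed for
`K = 1`; the label part runs at the order of the spectral gap, the stale part keeps Q13's factor `h` (item (ii) for the stale set is not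
re-derived here).  NOT CLAIMED: `K ≥ 2` (item 1 (i) proper: the `q`-point star with `q ≥ 3` and several cold levels outside chapter M's regime);
flows inexact within sectors; anything measured.  Literature grade (cell rule): OWN COMPOSITION of Q13 ∕ Q14 ∕ R4; nothing cited as a fact; no new
bib keys.
-/

noncomputable section

open Finset Function Matrix
open Literature.Probability.MarkovChains

namespace Summit.Ventures.LatticeQCDFlow.Scaling

variable {S : Type*} [Fintype S] [DecidableEq S] {L : Type*} [Fintype L] [DecidableEq L]
  {m : ℕ} {μ : Fin (1 + 1) → S → ℝ} {M : Fin (1 + 1) → S → S → ℝ} {w : Fin (1 + 1) → ℝ} {t : ℝ}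

section TwoLevelSectors
variable (κ : Fin m → Fin 1) (φ : Fin m → Equiv.Perm S) (ℓ : S → L)

/-- **THE COLD-START LAW FOR ONE COLD LEVEL AND ANY NUMBER OF SECTORS:**
`d(n) ≤ ((θ+1)/θ)(1 − min{h(1−θ)pct/m, (hθ−(1−θ)t)/(1+θ)})^{⌊n/2⌋} + 3(1 − p·t·h/(2(2t+h)))ⁿ`. [ours] -/
theorem sectorExact_twoLevel_worstTvDist_le [Nonempty L] (hm : 1 ≤ m) (ht0 : 0 < t) (ht1 : t < 1) (hw0 : ∀ k, 0 ≤ w k)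
    (hw00 : 0 < w 0) (hw1 : ∑ k, w k = 1) (hμ : ∀ k x, 0 < μ k x) (hμ1 : ∀ k, ∑ u, μ k u = 1) (hφℓ : ∀ r u, ℓ (φ r u) = ℓ u)
    {cL : Fin m → L → ℝ} (hcL : ∀ r b, 0 < cL r b) (hexact : ∀ r u, μ (κ r).succ (φ r u) = cL r (ℓ u) * μ 0 u)
    (hM : ∀ k, IsRowStochastic (M k)) (hM0 : ∀ u v, M 0 u v = μ 0 v)
    (hstat : ∀ k : Fin (1 + 1), k ≠ 0 → ∀ v, ∑ u, μ k u * M k u v = μ k v)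
    (hconf : ∀ k : Fin (1 + 1), k ≠ 0 → ∀ u v, ℓ u ≠ ℓ v → M k u v = 0)
    {μB : Fin (1 + 1) → L → ℝ} (hμB : ∀ k b, μB k b = ∑ u ∈ univ.filter (fun u => ℓ u = b), μ k u)
    (hμB0 : ∀ k b, 0 < μB k b) {p θ : ℝ} (hp0 : 0 < p) (hp1 : p ≤ 1) (hpc : ∀ r b, p * cL r b ≤ 1) (hθ0 : 0 < θ) (hθ1 : θ ≤ 1)
    (hreg : (1 - θ) * t ≤ (1 - t) * w 0 * θ) {c : ℕ} (hc : ∀ p' : Fin 1, c ≤ (univ.filter (fun r : Fin m => κ r = p')).card) (n : ℕ) :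
    worstTvDist (fun y z : Fin (1 + 1) → S =>
        t * ptGraphSwap μ (fun r : Fin m => (((0 : Fin (1 + 1)), (κ r).succ) : Fin (1 + 1) × Fin (1 + 1))) φ y z
          + (1 - t) * prodKernel w M y z) (tensorFun μ) n
      ≤ (θ + 1) / θ * (1 - min ((1 - t) * w 0 * (1 - θ) * p * c * t / m) (((1 - t) * w 0 * θ - (1 - θ) * t) / (1 + θ))) ^ (n / 2)
        + 3 * (1 - p * t * ((1 - t) * w 0) / (2 * (2 * t + (1 - t) * w 0))) ^ n := by
  obtain ⟨hμB1, -, -, -, hdomB⟩ := labelStar_basic κ φ ℓ hμ1 hφℓ hexact hμB hμB0 hpc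
  have h1 := sectorExact_worstTvDist_le_labelStar_dom κ φ ℓ hm ht0.le ht1.le hw0 hw1 hμ hμ1 hφℓ hcL hexact hM hM0 hstat hconf hμB hμB0
    hp0.le hpc hθ0 hθ1 hreg hc n
  -- the label star is the two-level scheme of chapter R: identity map, exact label redraw, idle cold label
  have hdom : ∀ b, p * μB 1 ((Equiv.refl L) b) ≤ μB 0 b := fun b => by
    have h := hdomB ⟨0, by omega⟩ b
    rwa [Fin.eq_zero (κ ⟨0, by omega⟩)] at h
  have h2 := twoLevelCycle_worstTvDist_le (M := fun (k : Fin (1 + 1)) (u v : L) => if k = 0 then μB 0 v else (if u = v then (1 : ℝ) else 0))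
    κ (Equiv.refl L) hm hμB0 hμB1 (fun u v => by simp) (fun u v => by
      simp only [Fin.isValue, one_ne_zero, if_false]; exact if_congr eq_comm rfl rfl) hw0 hw00 hw1 ht0 ht1 hp0 hp1 hdom n
  have hK1 : ((1 : ℕ) : ℝ) = 1 := Nat.cast_one
  simp only [hK1] at h1
  linarith [h1, h2]

/-- **THE MIXING TIME FOR ONE COLD LEVEL AND ANY NUMBER OF SECTORS** (`θ = 2t/(2t+h)`, `h = (1−t)w_0`):
**`t_mix(ε) ≤ max{2⌈ρ⁻¹·log(2(1+(2t+h)/(2t))/ε)⌉, ⌈(2(2t+h)/(p·t·h))·log(6/ε)⌉}`**, `ρ = (th/(2t+h))·min{hpc/m, 1/2}` — free of `|S|`, of every least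
mass and of any regime. [ours] -/
theorem sectorExact_twoLevel_mixingTime_le [Nonempty L] (hm : 1 ≤ m) (ht0 : 0 < t) (ht1 : t < 1) (hw0 : ∀ k, 0 ≤ w k)
    (hw00 : 0 < w 0) (hw1 : ∑ k, w k = 1) (hμ : ∀ k x, 0 < μ k x) (hμ1 : ∀ k, ∑ u, μ k u = 1) (hφℓ : ∀ r u, ℓ (φ r u) = ℓ u)
    {cL : Fin m → L → ℝ} (hcL : ∀ r b, 0 < cL r b) (hexact : ∀ r u, μ (κ r).succ (φ r u) = cL r (ℓ u) * μ 0 u)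
    (hM : ∀ k, IsRowStochastic (M k)) (hM0 : ∀ u v, M 0 u v = μ 0 v)
    (hstat : ∀ k : Fin (1 + 1), k ≠ 0 → ∀ v, ∑ u, μ k u * M k u v = μ k v)
    (hconf : ∀ k : Fin (1 + 1), k ≠ 0 → ∀ u v, ℓ u ≠ ℓ v → M k u v = 0)
    {μB : Fin (1 + 1) → L → ℝ} (hμB : ∀ k b, μB k b = ∑ u ∈ univ.filter (fun u => ℓ u = b), μ k u)
    (hμB0 : ∀ k b, 0 < μB k b) {p : ℝ} (hp0 : 0 < p) (hp1 : p ≤ 1) (hpc : ∀ r b, p * cL r b ≤ 1)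
    {c : ℕ} (hc1 : 1 ≤ c) (hc : ∀ p' : Fin 1, c ≤ (univ.filter (fun r : Fin m => κ r = p')).card) {ε : ℝ} (hε : 0 < ε) :
    mixingTime (fun y z : Fin (1 + 1) → S =>
        t * ptGraphSwap μ (fun r : Fin m => (((0 : Fin (1 + 1)), (κ r).succ) : Fin (1 + 1) × Fin (1 + 1))) φ y z
          + (1 - t) * prodKernel w M y z) (tensorFun μ) ε
      ≤ max (2 * ⌈1 / (t * ((1 - t) * w 0) / (2 * t + (1 - t) * w 0) * min ((1 - t) * w 0 * p * c / m) (1 / 2))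
              * Real.log (2 * (1 + (2 * t + (1 - t) * w 0) / (2 * t)) / ε)⌉₊)
          ⌈1 / (p * t * ((1 - t) * w 0) / (2 * (2 * t + (1 - t) * w 0))) * Real.log (6 / ε)⌉₊ := by
  set h := (1 - t) * w 0 with hh
  have hh0 : 0 < h := mul_pos (by linarith) hw00
  have hmpos : (0 : ℝ) < m := Nat.cast_pos.mpr (by omega)
  have hcpos : (0 : ℝ) < c := Nat.cast_pos.mpr (by omega)
  have hw01 : w 0 ≤ 1 := by
    calc w 0 ≤ ∑ k, w k := Finset.single_le_sum (fun k _ => hw0 k) (mem_univ 0)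
      _ = 1 := hw1
  have hh1 : h ≤ 1 := by rw [hh]; nlinarith
  -- the tuned `θ`
  set θ := 2 * t / (2 * t + h) with hθ
  have hθ0 : 0 < θ := by positivity
  have hθ1 : θ ≤ 1 := by rw [hθ, div_le_one (by positivity)]; linarith
  have h1θ : 1 - θ = h / (2 * t + h) := by rw [hθ]; field_simp; ring
  have hreg : (1 - θ) * t ≤ (1 - t) * w 0 * θ := by
    rw [h1θ, ← hh, hθ]
    rw [div_mul_eq_mul_div, mul_div_assoc', div_le_div_iff_of_pos_right (by positivity)]
    nlinarith [mul_pos ht0 hh0]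
  -- the two rates and the constant
  set ρ := t * h / (2 * t + h) * min (h * p * c / m) (1 / 2) with hρ
  have hρ0 : 0 < ρ := by
    have : 0 < min (h * p * c / (m : ℝ)) (1 / 2) := lt_min (by positivity) (by norm_num)
    positivity
  have hρ1 : ρ ≤ 1 := by
    have h1' : t * h / (2 * t + h) ≤ 1 := by rw [div_le_one (by positivity)]; nlinarith [mul_pos ht0 hh0]
    have h2' : min (h * p * c / (m : ℝ)) (1 / 2) ≤ 1 := (min_le_right _ _).trans (by norm_num)
    have h3' : 0 ≤ min (h * p * c / (m : ℝ)) (1 / 2) := le_min (by positivity) (by norm_num)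
    calc ρ ≤ 1 * 1 := mul_le_mul h1' h2' h3' zero_le_one
      _ = 1 := one_mul 1
  set ρR := p * t * h / (2 * (2 * t + h)) with hρR
  have hρR0 : 0 < ρR := by positivity
  have hρR1 : ρR ≤ 1 := by
    rw [hρR, div_le_one (by positivity)]
    nlinarith [mul_le_mul_of_nonneg_left hh1 (mul_nonneg hp0.le ht0.le), mul_nonneg hp0.le ht0.le,
      mul_le_mul_of_nonneg_right hp1 ht0.le]
  set C₁ := 1 + (2 * t + h) / (2 * t) with hC₁
  have hC₁0 : 0 < C₁ := by positivity
  set N₁ : ℕ := ⌈1 / ρ * Real.log (2 * C₁ / ε)⌉₊ with hN₁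
  set N₂ : ℕ := ⌈1 / ρR * Real.log (6 / ε)⌉₊ with hN₂
  set n : ℕ := max (2 * N₁) N₂ with hn
  have hlaw := sectorExact_twoLevel_worstTvDist_le κ φ ℓ hm ht0 ht1 hw0 hw00 hw1 hμ hμ1 hφℓ hcL hexact hM hM0 hstat hconf hμB hμB0
    hp0 hp1 hpc hθ0 hθ1 hreg hc n
  -- the stale part
  have hrate : ρ ≤ min ((1 - t) * w 0 * (1 - θ) * p * c * t / m) (((1 - t) * w 0 * θ - (1 - θ) * t) / (1 + θ)) := by
    refine le_min ?_ ?_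
    · calc ρ ≤ t * h / (2 * t + h) * (h * p * c / m) := mul_le_mul_of_nonneg_left (min_le_left _ _) (by positivity)
        _ = (1 - t) * w 0 * (1 - θ) * p * c * t / m := by rw [h1θ, ← hh]; ring
    · calc ρ ≤ t * h / (2 * t + h) * (1 / 2) := mul_le_mul_of_nonneg_left (min_le_right _ _) (by positivity)
        _ ≤ t * h / (2 * t + h) * (1 / (1 + θ)) := by gcongr; linarith
        _ = ((1 - t) * w 0 * θ - (1 - θ) * t) / (1 + θ) := by rw [← hh, h1θ, hθ]; field_simp; ring
  have hconst : (θ + 1) / θ = C₁ := by rw [hC₁, hθ]; field_simp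
  have hbase0 : 0 ≤ 1 - min ((1 - t) * w 0 * (1 - θ) * p * c * t / m) (((1 - t) * w 0 * θ - (1 - θ) * t) / (1 + θ)) := by
    have h2' : min ((1 - t) * w 0 * (1 - θ) * p * c * t / m) (((1 - t) * w 0 * θ - (1 - θ) * t) / (1 + θ))
        ≤ ((1 - t) * w 0 * θ - (1 - θ) * t) / (1 + θ) := min_le_right _ _
    have h3' : ((1 - t) * w 0 * θ - (1 - θ) * t) / (1 + θ) ≤ 1 := by
      rw [div_le_one (by positivity)]
      nlinarith [mul_nonneg (sub_nonneg.mpr ht1.le) (hw0 0), mul_nonneg (sub_nonneg.mpr hθ1) ht0.le, hθ0.le,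
        mul_le_mul_of_nonneg_left hw01 (sub_nonneg.mpr ht1.le)]
    linarith
  have hn1 : N₁ ≤ n / 2 := by omega
  have hfirst : (θ + 1) / θ * (1 - min ((1 - t) * w 0 * (1 - θ) * p * c * t / m)
      (((1 - t) * w 0 * θ - (1 - θ) * t) / (1 + θ))) ^ (n / 2) ≤ ε / 2 := by
    have hg := geom_le_of_ge_log hρ0 hρ1 (by positivity : 0 < 2 * C₁) hε (n := N₁) (Nat.le_ceil _)
    calc (θ + 1) / θ * (1 - min ((1 - t) * w 0 * (1 - θ) * p * c * t / m) (((1 - t) * w 0 * θ - (1 - θ) * t) / (1 + θ))) ^ (n / 2)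
        ≤ C₁ * (1 - ρ) ^ (n / 2) := by
          rw [hconst]
          exact mul_le_mul_of_nonneg_left (pow_le_pow_left₀ hbase0 (by linarith [hrate]) _) hC₁0.le
      _ ≤ C₁ * (1 - ρ) ^ N₁ := mul_le_mul_of_nonneg_left (pow_le_pow_of_le_one (by linarith) (by linarith) hn1) hC₁0.le
      _ = (2 * C₁ * (1 - ρ) ^ N₁) / 2 := by ring
      _ ≤ ε / 2 := by linarith [hg]
  -- the label part
  have hn2 : N₂ ≤ n := le_max_right _ _
  have hsecond : 3 * (1 - p * t * ((1 - t) * w 0) / (2 * (2 * t + (1 - t) * w 0))) ^ n ≤ ε / 2 := by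
    have hg := geom_le_of_ge_log hρR0 hρR1 (by norm_num : (0 : ℝ) < 6) hε (n := N₂) (Nat.le_ceil _)
    rw [← hh]
    calc 3 * (1 - ρR) ^ n ≤ 3 * (1 - ρR) ^ N₂ :=
          mul_le_mul_of_nonneg_left (pow_le_pow_of_le_one (by linarith) (by linarith) hn2) (by norm_num)
      _ = (6 * (1 - ρR) ^ N₂) / 2 := by ring
      _ ≤ ε / 2 := by linarith [hg]
  refine mixingTime_le _ _ (t₀ := n) (hlaw.trans ?_)
  linarith [hfirst, hsecond]

end TwoLevelSectors

end Summit.Ventures.LatticeQCDFlow.Scaling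

end
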